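import Summits.QuantumAdvantage.QuantumAdvantage.Statement
import Summits.QuantumAdvantage.QuantumAdvantage.Theorems.SoloBlindCeiling
import Literature.Computability.QuantumComplexity.AWPPLowForPP
import Literature.Computability.QuantumComplexity.CountingSimulationProofs
import Literature.Computability.QuantumComplexity.BQPContainmentsProofs
import Literature.Computability.Complexity.CountingHierarchyOracle
import Literature.Computability.Complexity.Reductions
import Literature.Computability.Complexity.ProbabilisticClassesProofs
import HarnessLib

/-!
# The witness of `QuantumAdvantage` is low for `PP`: a hardness cap on the `∃ L` side

`QuantumAdvantage` is `∃ L, L ∈ BQP ∧ L ∉ BPP`. The other files of this series index what the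
statement IMPLIES and what implies it; this one records a kernel-checked constraint on the
WITNESS `L` itself, assembled from two discharged Literature theorems:

* Fortnow–Rogers 1999, Thm. 1.1 / Cor. 4.3, in the tree as `BQP_subset_AWPP_holds` and
  `AWPPLow.AWPP_low_PP` (every `AWPP` language is low for `PP`);
* Torán 1991, §4, in the tree as `CkP_succ_eq_PPRelClass_holds` (`Cₖ₊₁P = PP^{CₖP}`).

Consequences proved here (all sorry-free):

* `soloBlind_PPRel_eq_PP_of_mem_BQP`: every `L ∈ BQP` — in particular every witness of the summit
  (`soloBlind_witness_low_PP`) — satisfies `PP^L = PP`;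
* `soloBlind_CH_eq_PP_of_PP_subset_BQP`: if `PP ⊆ BQP` (equivalently `BQP = PP`,
  `soloBlind_PP_subset_BQP_iff`) then Wagner's counting hierarchy collapses, `CH = PP = BQP`;
* `soloBlind_collapse_of_isHard_witness`: hence a summit witness that is `PP`-hard under Karp
  reductions forces `BQP = PP = CH`, granted closure of `BQP` under Karp reductions (taken as an
  explicit hypothesis: the tree has no composition theorem for polynomial-time machines, cf.
  `PolyTimeKarpReducible.trans`);
* `soloBlind_summit_and_PP_subset_BQP_iff`: "the summit holds with `PP ⊆ BQP`" is exactly the world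
  `BQP = PP ∧ PP ⊄ BPP`, in which `CH = PP`.

Reading (witness census): unless the counting hierarchy collapses to `PP`, the separating language
cannot be `PP`-hard; unless `NP ⊆ BQP`, it cannot be `NP`-hard; no `BQP`-complete LANGUAGE is
known. So the witness must be a problem of "intermediate" status with no completeness structure to
lean on — every explicit candidate in print (factoring, discrete logarithm, Pell/principal ideal,
bits of zeta functions of curves) is an instantiation of abelian hidden-subgroup period finding.
Nothing here is progress towards the summit; it is a certified constraint on its witness.

References: L. Fortnow, J. Rogers, *Complexity limitations on quantum computation*, JCSS 59
(1999) 240–252, Thm. 1.1, Cor. 4.3; J. Torán, *Complexity classes defined by counting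
quantifiers*, J. ACM 38 (1991) 753–774, §4; K. W. Wagner, Acta Inform. 23 (1986) 325–356.
-/

namespace Summit.QuantumAdvantage.QuantumAdvantage.Theorems

open Literature.Computability.Complexity Literature.Computability.Complexity.Classes
  Literature.Computability.Cryptography Literature.Computability.QuantumComplexity

/-- Every `BQP` language is low for `PP`: `PP^L = PP` (Fortnow–Rogers 1999, Cor. 4.3, from the
discharged `BQP ⊆ AWPP` and `AWPP` lowness; `⊇` is `PP ⊆ PP^O`). -/
theorem soloBlind_PPRel_eq_PP_of_mem_BQP {L : Language Bool} (hL : L ∈ BQP) :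
    PPRel (Oracle.ofLanguage L) = PP :=
  Set.Subset.antisymm (AWPPLow.AWPP_low_PP L (BQP_subset_AWPP_holds hL)) (PP_subset_PPRel _)

/-- In particular every witness of `QuantumAdvantage` is low for `PP`. -/
theorem soloBlind_witness_low_PP {L : Language Bool} (h : L ∈ BQP ∧ L ∉ BPP) :
    PPRel (Oracle.ofLanguage L) = PP :=
  soloBlind_PPRel_eq_PP_of_mem_BQP h.1

/-- `PP^C ⊆ PP` for every class `C ⊆ BQP` of oracle languages. -/
theorem soloBlind_PPRelClass_subset_PP_of_subset_BQP {C : Set (Language Bool)} (hC : C ⊆ BQP) :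
    PPRelClass C ⊆ PP := by
  intro A hA
  obtain ⟨B, hB, hAB⟩ := Set.mem_iUnion₂.1 hA
  exact (soloBlind_PPRel_eq_PP_of_mem_BQP (hC hB)).le hAB

/-- `PP ⊆ BQP ↔ BQP = PP` (with the discharged `BQP ⊆ PP`, Adleman–DeMarrais–Huang 1997). -/
theorem soloBlind_PP_subset_BQP_iff : PP ⊆ BQP ↔ BQP = PP :=
  ⟨fun h => Set.Subset.antisymm BQP_subset_PP_holds h, fun h => h.ge⟩

/-- If `PP ⊆ BQP` then every level `Cₖ₊₁P` of the counting hierarchy is `PP`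
(induction on `k` with Torán's `Cₖ₊₂P = PP^{Cₖ₊₁P}` and `PP^{BQP} = PP`). -/
theorem soloBlind_CkP_succ_subset_PP_of_PP_subset_BQP (h : PP ⊆ BQP) (k : ℕ) :
    CkP (k + 1) ⊆ PP := by
  induction k with
  | zero => exact CkP_one.le
  | succ k ih =>
      rw [CkP_succ_eq_PPRelClass_holds (k + 1)]
      exact soloBlind_PPRelClass_subset_PP_of_subset_BQP (ih.trans h)

/-- `P ⊆ PP` along the discharged sandwich `P ⊆ BPP ⊆ BQP ⊆ PP`. -/
theorem soloBlind_P_subset_PP : P ⊆ PP :=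
  (P_subset_BPP_holds.trans BPP_subset_BQP_holds).trans BQP_subset_PP_holds

/-- **Counting-hierarchy collapse.** If `PP ⊆ BQP` then `CH = PP`. -/
theorem soloBlind_CH_eq_PP_of_PP_subset_BQP (h : PP ⊆ BQP) : CH = PP := by
  refine Set.Subset.antisymm (fun L hL => ?_) PP_subset_CH
  obtain ⟨k, hk⟩ := mem_CH_iff.1 hL
  cases k with
  | zero => exact soloBlind_P_subset_PP (by simpa [CkP_zero] using hk)
  | succ k => exact soloBlind_CkP_succ_subset_PP_of_PP_subset_BQP h k hk

/-- If `PP ⊆ BQP` then `CH = BQP`. -/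
theorem soloBlind_CH_eq_BQP_of_PP_subset_BQP (h : PP ⊆ BQP) : CH = BQP :=
  (soloBlind_CH_eq_PP_of_PP_subset_BQP h).trans (soloBlind_PP_subset_BQP_iff.1 h).symm

/-- **Hardness cap on the witness.** If some `L ∈ BQP` is `PP`-hard under Karp reductions and `BQP`
is closed downwards under Karp reductions (hypothesis `hclosed`; the standard closure, whose proof
needs composition of polynomial-time machines, absent from the tree), then `BQP = PP` and the
counting hierarchy collapses to `PP`. -/
theorem soloBlind_collapse_of_isHard_witness {L : Language Bool} (hL : L ∈ BQP)
    (hhard : IsHard PP L)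
    (hclosed : ∀ ⦃L₁ L₂ : Language Bool⦄, PolyTimeKarpReducible L₁ L₂ → L₂ ∈ BQP → L₁ ∈ BQP) :
    BQP = PP ∧ CH = PP :=
  have h : PP ⊆ BQP := fun L' hL' => hclosed (hhard L' hL') hL
  ⟨soloBlind_PP_subset_BQP_iff.1 h, soloBlind_CH_eq_PP_of_PP_subset_BQP h⟩

/-- The same cap for `NP`: an `NP`-hard witness in `BQP` puts `NP ⊆ BQP` (closure hypothesis as
above). -/
theorem soloBlind_NP_subset_BQP_of_isNPHard_witness {L : Language Bool} (hL : L ∈ BQP)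
    (hhard : IsNPHard L)
    (hclosed : ∀ ⦃L₁ L₂ : Language Bool⦄, PolyTimeKarpReducible L₁ L₂ → L₂ ∈ BQP → L₁ ∈ BQP) :
    Nondeterministic.NP ⊆ BQP :=
  fun L' hL' => hclosed (hhard L' hL') hL

/-- **The `PP`-hard-witness world.** "`QuantumAdvantage` holds and `PP ⊆ BQP`" is exactly
"`BQP = PP` and `PP ⊄ BPP`". -/
theorem soloBlind_summit_and_PP_subset_BQP_iff :
    (_root_.QuantumAdvantage ∧ PP ⊆ BQP) ↔ (BQP = PP ∧ ¬ (PP ⊆ BPP)) := by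
  constructor
  · rintro ⟨hS, h⟩
    exact ⟨soloBlind_PP_subset_BQP_iff.1 h, soloBlind_not_PP_subset_BPP hS⟩
  · rintro ⟨he, hn⟩
    refine ⟨?_, he.ge⟩
    by_contra hS
    have hsub : BQP ⊆ BPP := by
      by_contra hns
      exact hS (soloBlind_quantumAdvantage_iff_not_subset.2 hns)
    exact hn (he.ge.trans hsub)

/-- … and in that world the counting hierarchy is `PP`. -/
theorem soloBlind_CH_eq_PP_of_summit_and_PP_subset_BQP
    (h : _root_.QuantumAdvantage ∧ PP ⊆ BQP) : CH = PP :=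
  soloBlind_CH_eq_PP_of_PP_subset_BQP h.2

end Summit.QuantumAdvantage.QuantumAdvantage.Theorems
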